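import Summits.QuantumFields.YangMills.Theorems.IRcofFluxInterlacingLineDefs
import Summits.QuantumFields.YangMills.Theorems.IR.LevelwiseDominationKernel
import HarnessLib

/-!
# Line `flux-interlacing` v3 for crux `IRcof` (stmt-QuantumFields-26930) — SUPPLIER ARROW #2, stub I RESTATED WITH A PHYSICAL-SIZE FLOOR

v3 = the skeleton of `flux_interlacing_v2.lean` (1bda929b912cc52d; crit-1 CUT-10 PASS·ELIGIBLE, stub I open) with its LEVER stub
I ∕ I_spec RESTATED per the critic's READING of FOREST-R665 (`pub/ym-gapexp/forest-r665/READING-R665-crit1-g1.md` 5f04cffcc737a291,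
R5 PRICE; director-ym R677-ym AMENDED (A2) (2)).  What R665 (kit j343657, Package P) measured: on every box of the grid `L/a ≤ 16`,
`β_W ∈ [2.2, 2.5]` the purity hypothesis `projDefect ≤ ε₀` of v2's I is UNMET (`ε′ ≥ 0.14` everywhere), so I was VACUOUSLY SAFE there;
its content — and the 1∕32 cap of arrow #3's `Seed` — lives in `4:1` boxes of FIXED PHYSICAL SIZE `≳ 3–4 fm` at every `β`
(on the lattice `L/a ≳ 4·N_{t,c}(β) → ∞` like `1/a`).  v2 selected that regime only LOGARITHMICALLY, through `ε₀` (CUT-5∕6∕10: a prover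
of I owed «`ε₀ < 2d·e^{−m/T_c}`, hence neutral `ε₀`-purity ⇒ `T < T_c`»), which is exactly why no measurable box could price `κ`.

THE RESTATEMENT (this file).  The regime is now selected GEOMETRICALLY, in the floor's own units: the unit map `a` and the floor
`LowerBounds G r a` of PXcof ∕ IRcof enter stub I's binders, and I claims interlacing only on `4:1` boxes of physical size at least `S₀`:

* I⁺_spec = `SpectralFluxInterlacingPhys` — **THE STUB (LEVER, E-type, width 0)**: for s.c. compact simple Lie `G`, every `r`, every
  positive unit map `a → 0` with `LowerBounds G r a`: `∃ κ ≥ 0, β₀, S₀ > 0` such that for every `β ≥ β₀`, every `L ≥ 8` with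
  `S₀ ≤ a(β)·L`, and every projection datum `(z, n)`, the box `L³×(L/4)` is SPECTRALLY `κ`-interlaced (`SpectralInterlacedAt`, ✓p819112:
  in every adapted eigenbasis with neutral vacuum, electric-flux weight `≤ (κ/2)·`excited-glue weight at `t = L/4`).  NO purity guard:
  the triple is `(κ, β₀, S₀)`; `κ` does not depend on `β` or on the box.  PRICEABLE: P+ (Tier B, cold boxes `(16, 2.2)`, `(20, 2.3)`,
  `(24, 2.4)`, `a·L ≈ 3.35 ∕ 3.3 ∕ 2.9 fm` at the held `a√σ`) reads `κ_needed(S) = 2·C/E` (spec §7.3, READING R4) at physical sizes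
  `S` at ∕ above the line's bet `S₀ ≈ 3 fm-equivalent`.  NECESSARY: `S₀ ≳ 4/T_c ≈ 2.6–2.7 fm-equivalent` — below it the `4:1` box is
  finite-temperature DECONFINED and realises the light-flux pattern of the decided negative toy `not_interlaced_of_light_flux`
  (`C = (n³ − 1)·A`, no `κ` works); R665 measured nine such boxes.
* I⁺ = `FluxInterlacingPhys` — the same with the `InterlacedAt` conclusion; DERIVED (`fluxInterlacingPhys_of_spectral`, via ✓p819112
  `interlacedAt_of_spectral`).
* V⁺ = `NeutralPurityWindowCof` — RESIDUAL (declared B2), v2's V with the matching physical-size WINDOW: for every `ε > 0` and every floor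
  `S₀` there is a cap `T` (so `T ≥ S₀`: «T pinned ≥ S₀», R5) such that cofinally in `β` SOME `L ≥ 8` with `S₀ ≤ a(β)·L ≤ T` has an
  `ε`-pure neutral sector for SOME projection datum.  Physically the pure boxes ARE the large ones; the window costs V nothing new.
* N = `stub_irnscCof : IRnscCof` — SHARED with the slot of record `pinned_cofinal_bill` (d3255819134117aa; UNCHANGED, not registered here).

COMPOSITION (sorry-free): written against the WEAKEST sufficient form `SpectralFluxInterlacingPhysPure` (floor AND an arbitrary purity
guard `ε₀ > 0`), which is implied BOTH by the v3 stub (`physPure_of_phys`, `ε₀ := 1`) AND by v2's purity-guarded I_spec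
`Theorems.IRcofFluxInterlacingLine.SpectralFluxInterlacingEv` (`physPure_of_spectralFluxInterlacingEv`, `S₀ := 1`) — a v2 prover loses
nothing.  `pinnedExitsCofinal_of_window_interlacing : V⁺ → I⁺_pure → PXcof(1∕24)` (`ε := 1/(24(1+2κ))`), then
`IRcof_of : Summit.QuantumFields.YangMills.Theses.BalabanLadder.IRcof` BY NAME over the landed kernel
`LevelwiseDomination.IRcof_of_pinnedExitsCofinalAt` with N.  Real-number core (§3) byte-identical to v2 §2–§3.

TOYS (rule (N) ∕ ‼T): `floor_inhabited` (I⁺'s hypothesis shape is inhabited for every positive `a`), `window_inhabited` (V⁺'s window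
`S₀ ≤ a(β)·L ≤ T` is servable cofinally for every positive `a → 0`), `projZ_beta_zero` ∕ `projDefect_beta_zero` ∕ `interlacedAt_beta_zero` ∕
`spectralInterlacedAt_beta_zero` (conclusion shapes of I⁺ and I⁺_spec inhabited in-model at the Haar point), `not_interlaced_of_light_flux`
(DECIDED NEGATIVE: the sub-floor ∕ deconfined ∕ finite-`G` pattern violates interlacing for every `κ`).

UNITS NOTE (why a floor in the abstract units `a` means «confined»; INFO-class heuristics, the SAME exposure PXcof's own cap
`a(β)·L ≤ T` carries): `S₀` is chosen AFTER `a`.  If an admissible `a` OVERSTATED the physical spacing by an unbounded factor along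
`β → ∞` (`a = λ·a_phys`, `λ → ∞`), the boxes `a(β)·L ≥ S₀` would have true size `S₀/λ → 0` (deconfined) and I⁺ would be false for
that `a`; but then the `Q2` clause of `LowerBounds G r a` fails: its test functions `v(a(β)·x)` probe TRUE distances `∝ 1/λ → 0`,
where the reflected connected two-point function of the curvature density (`≈ a⁴·g₀²F²`, the RG-invariant trace-anomaly density to
leading order) is suppressed by `1/log²λ` (asymptotic freedom), so no floor `ε > 0` survives.  Hence along `β ≥ β₅` an admissible `a`
is at most a bounded multiple `Λ(a)` of the physical spacing, and `S₀ := Λ(a)·S₀^phys` makes `a(β)·L ≥ S₀` a TRUE lower bound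
`≥ S₀^phys`.  (The opposite distortion, `λ → 0`, only makes the boxes in regime larger.)  A prover of I⁺_spec owes this step.

PRE-REGISTERED PRICES (heuristic dictionary, INFO; inputs: held SU(2) `√σ = 440 MeV`, `T_c = 0.69√σ`, `m_G = 3.7√σ`, `a√σ(β)` of
the cell's table; excited-glue weight `X_t(S) = V·T³·(m_G/2πT)^{3/2}·e^{−m_G/T}` at `T = 4/S`, `V·T³ = 64`; flux weight
`C/A₁ = 3e^{−x} + 3e^{−√2·x} + e^{−√3·x}`, `x = σ(T)·S²/4`, `σ(T)/σ₀ ≈ 1.2(1 − T/T_c)^{0.63}`; `κ_needed = 2·(C/A₁)·(1 + X_t)/X_t`):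
CHECK against R665 (no fit): neutral defect `projDefect ≈ 1 − (1 + X_{2t})/(1 + X_t)²` = 0.13 ∕ 0.33 ∕ 0.37 at (16, 2.2) ∕ (16, 2.3) ∕
(12, 2.2) vs MEASURED `ε′` = 0.14 ∕ 0.31 ∕ 0.42; hot boxes `C/A₁ = 7` = R4's `κ* = 7.000`.  EXPECTATION for P+: (16, 2.2) `a·L ≈ 3.37 fm`,
`T/T_c ≈ 0.77`: `κ_needed ≈ 0.1`; (20, 2.3) `3.31 fm`, `0.79`: `≈ 0.2` (same physical size at another `β`: SCALING TEST, ratio ≈ 1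
expected); (24, 2.4) `2.86 fm`, `0.91`: `≈ 4` (×3 either way: near-critical `σ(T)`); floor `4/T_c ≈ 2.6 fm`: `κ_needed → ∞`
((16, 2.3) at 2.65 fm: ≈ 30).  WHAT P+ PRICES: `κ(S₀) := sup_{S ≥ S₀} κ_needed(S)` at `S₀ ∈ {2.86, 3.31, 3.37} fm` (monotone in
`S` above ≈ 1 fm: flux cost `∝ S²` vs glue gas `∝ e^{−m_G S/4}`); the stub is closed by ANY one pair `(S₀, κ(S₀))`; the LINE'S BET is the
pair at `S₀ = a(2.4)·24 ≈ 2.9 fm-equivalent`, `κ ≈ 4` (×3), so the number P+ measures there IS the line's `κ`; rows (16, 2.2)∕(20, 2.3)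
are the `β`-uniformity (scaling) control at fixed `S ≈ 3.3 fm`.  V⁺'s window must then reach `T ≈ 4.5–5.5 fm-equivalent`, where
`ε = 1/(24(1+2κ))`-purity (`X_t ≲ ε/2`) first holds — the PXcof cap `T` of the composition («T pinned ≥ S₀ ≥ 2.9 fm-equivalent»).

HONEST FRAMING: workfile ∕ supplier arrow #2; NOT the line of record, NOT registered (registry word is crit-1's); nothing here proves
I⁺, V⁺, N, `PinnedExitsCofinalAt (1/24)`, `IRcof`, `IR`, any leg, or the Yang–Mills mass gap (Clay) — NOT proved; finite-volume ∕
conditional; the R665 numbers are exposure ∕ pricing INFO, they prove and refute nothing.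

References: G. 't Hooft, Nucl. Phys. B 153 (1979) 141 §§4–5 (twists, electric flux, `exp(−F(e)/T)`); C. Borgs, E. Seiler, Commun.
Math. Phys. 91 (1983) 329 (confinement ⇔ deconfinement via twisted b.c. at finite T); J. Engels, J. Fingberg, M. Weber, Nucl. Phys. B 332
(1990) 737 and J. Fingberg, U. Heller, F. Karsch, Nucl. Phys. B 392 (1993) 493 (SU(2) `β_c(N_t)`, `T_c/√σ ≈ 0.69`); P. de Forcrand,
L. von Smekal, Phys. Rev. D 66 (2002) 011504 ('t Hooft loops ∕ electric-flux free energies in SU(2)); K. Osterwalder, E. Seiler, Ann. Phys.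
110 (1978) 440 and G. Münster, Nucl. Phys. B 190 (1981) 439 (strong coupling, `InterlacingSC`).
-/

set_option autoImplicit false

noncomputable section

open Filter Topology MeasureTheory
open scoped BigOperators
open Literature.MathematicalPhysics.QuantumFieldTheory Literature.MathematicalPhysics.QuantumLattice
open Summit.QuantumFields.YangMills.Cruxes.OSLegsFromFemtoAndGap.DlrCollarTransfer (LowerBounds)
open Summit.QuantumFields.YangMills.Cruxes.IR.ColdPurityBridge (coldDefect)
open Summit.QuantumFields.YangMills.Cruxes.IR.RankPurity (IRnscCof)
open Summit.QuantumFields.YangMills.Cruxes.IRcof.RunningLandmark (PinnedExitsCofinalAt)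
open Summit.QuantumFields.YangMills.Cruxes.IRcof.TemporalTwistSubadditivity (eTwist projZ projDefect eTwist_center)
open Summit.QuantumFields.YangMills.Theorems.IRcofFluxInterlacingLine
  (IsProjDatum InterlacedAt SpectralInterlacedAt SpectralFluxInterlacingEv interlacedAt_of_spectral)

namespace Summit.QuantumFields.YangMills.Cruxes.IRcof.Lines.FluxInterlacingV3

/-! ## §0 Statements (the currency `IsProjDatum`, `InterlacedAt`, `SpectralInterlacedAt` is ✓p819112's, BY NAME — no copies) -/

/-- **V⁺ — `NeutralPurityWindowCof` (RESIDUAL, declared B2)**: pinned cofinal `ε`-purity of SOME `⟨z⟩³` e-projection in a `4:1` box of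
physical size in ANY requested window `[S₀, T]` (`T` after `ε, S₀`; `β` cofinal; `L` after `β`).  v2's `NeutralPurityCof` is the case
`S₀ = 0`.  «T pinned ≥ S₀» is forced by the shape. -/
def NeutralPurityWindowCof : Prop :=
  ∀ (G : Type) [Group G] [TopologicalSpace G] [IsTopologicalGroup G] [CompactSpace G],
    IsCompactSimpleLieGroup G → SimplyConnectedSpace G →
    letI : MeasurableSpace G := borel G
    haveI : BorelSpace G := ⟨rfl⟩
    ∀ (r : LatticeRep G) (a : ℝ → ℝ), (∀ β, 0 < a β) → Tendsto a atTop (𝓝 0) → LowerBounds G r a →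
      ∀ ε : ℝ, 0 < ε → ∀ S₀ : ℝ, ∃ T : ℝ, ∀ β₁ : ℝ, ∃ β : ℝ, β₁ ≤ β ∧ ∃ L : ℕ, 8 ≤ L ∧
        S₀ ≤ a β * (L : ℝ) ∧ a β * (L : ℝ) ≤ T ∧ ∃ (z : G) (n : ℕ), IsProjDatum z n ∧ projDefect r.ρ β z n L (L / 4) ≤ ε

/-- **I⁺_spec — `SpectralFluxInterlacingPhys` (THE STUB; LEVER, E-type, width 0; PRICEABLE)**: above a physical-size floor `S₀` (in the
floor's units `a`) and a coupling `β₀`, EVERY `4:1` box is spectrally `κ`-interlaced for every projection datum — electric-flux spectral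
weight `≤ (κ/2) ×` excited-glue spectral weight at `t = L/4` in every adapted eigenbasis with neutral vacuum (✓p819112
`SpectralInterlacedAt`).  One `κ` for all `β ≥ β₀` and all boxes; NO purity guard.  Necessary price: `S₀ ≳ 4/T_c`-equivalent. -/
def SpectralFluxInterlacingPhys : Prop :=
  ∀ (G : Type) [Group G] [TopologicalSpace G] [IsTopologicalGroup G] [CompactSpace G],
    IsCompactSimpleLieGroup G → SimplyConnectedSpace G →
    letI : MeasurableSpace G := borel G
    haveI : BorelSpace G := ⟨rfl⟩
    ∀ (r : LatticeRep G) (a : ℝ → ℝ), (∀ β, 0 < a β) → Tendsto a atTop (𝓝 0) → LowerBounds G r a →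
      ∃ κ β₀ S₀ : ℝ, 0 ≤ κ ∧ 0 < S₀ ∧ ∀ β : ℝ, β₀ ≤ β → ∀ L : ℕ, 8 ≤ L → S₀ ≤ a β * (L : ℝ) →
        ∀ (z : G) (n : ℕ), IsProjDatum z n → SpectralInterlacedAt r.ρ β z n κ L

/-- **I⁺ — `FluxInterlacingPhys`**: the same claim with the trace-level conclusion `InterlacedAt` (charged trace `≤ κ ×` the excited-neutral
proxy `projZ(t) − √projZ(2t)`).  DERIVED from I⁺_spec (`fluxInterlacingPhys_of_spectral`). -/
def FluxInterlacingPhys : Prop :=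
  ∀ (G : Type) [Group G] [TopologicalSpace G] [IsTopologicalGroup G] [CompactSpace G],
    IsCompactSimpleLieGroup G → SimplyConnectedSpace G →
    letI : MeasurableSpace G := borel G
    haveI : BorelSpace G := ⟨rfl⟩
    ∀ (r : LatticeRep G) (a : ℝ → ℝ), (∀ β, 0 < a β) → Tendsto a atTop (𝓝 0) → LowerBounds G r a →
      ∃ κ β₀ S₀ : ℝ, 0 ≤ κ ∧ 0 < S₀ ∧ ∀ β : ℝ, β₀ ≤ β → ∀ L : ℕ, 8 ≤ L → S₀ ≤ a β * (L : ℝ) →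
        ∀ (z : G) (n : ℕ), IsProjDatum z n → InterlacedAt r.ρ β z n κ L

/-- **I⁺_pure — `SpectralFluxInterlacingPhysPure` (the WEAKEST form the composition needs; NOT a stub)**: floor `S₀` AND a purity guard
`projDefect ≤ ε₀` for an arbitrary `ε₀ > 0`.  Implied by the v3 stub (`ε₀ := 1`) and by v2's I_spec (`S₀ := 1`).  Not priceable unless
`ε₀` is large (R665: `ε′ ≥ 0.14` on every measured box) — documented fallback only. -/
def SpectralFluxInterlacingPhysPure : Prop :=
  ∀ (G : Type) [Group G] [TopologicalSpace G] [IsTopologicalGroup G] [CompactSpace G],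
    IsCompactSimpleLieGroup G → SimplyConnectedSpace G →
    letI : MeasurableSpace G := borel G
    haveI : BorelSpace G := ⟨rfl⟩
    ∀ (r : LatticeRep G) (a : ℝ → ℝ), (∀ β, 0 < a β) → Tendsto a atTop (𝓝 0) → LowerBounds G r a →
      ∃ κ ε₀ β₀ S₀ : ℝ, 0 ≤ κ ∧ 0 < ε₀ ∧ 0 < S₀ ∧ ∀ β : ℝ, β₀ ≤ β → ∀ L : ℕ, 8 ≤ L → S₀ ≤ a β * (L : ℝ) →
        ∀ (z : G) (n : ℕ), IsProjDatum z n → projDefect r.ρ β z n L (L / 4) ≤ ε₀ → SpectralInterlacedAt r.ρ β z n κ L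

/-! ## §1 Stubs (sorries ONLY here) -/

/-- **stub V⁺ — `NeutralPurityWindowCof` (RESIDUAL, declared B2; v2's V with the physical-size window)** -/
theorem stub_neutralPurityWindowCof : NeutralPurityWindowCof := by sorry

/-- **stub I⁺_spec — `SpectralFluxInterlacingPhys` (LEVER, E-type, width 0; confinement of `4:1` boxes above a fixed physical size, in
spectral form; PRICEABLE by P+)** — hypothesis-shaped named stub. -/
theorem stub_spectralFluxInterlacingPhys : SpectralFluxInterlacingPhys := by sorry

/-- **stub N — `IRnscCof` (SHARED with the slot of record `pinned_cofinal_bill`)** -/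
theorem stub_irnscCof : IRnscCof := by sorry

/-! ## §2 Reductions between the forms of I -/

/-- The v3 stub implies the guarded-and-floored form (`ε₀ := 1`, guard ignored). -/
theorem physPure_of_phys (h : SpectralFluxInterlacingPhys) : SpectralFluxInterlacingPhysPure := by
  intro G _ _ _ _ hG hsc
  letI : MeasurableSpace G := borel G
  haveI : BorelSpace G := ⟨rfl⟩
  intro r a ha ha0 hlb
  obtain ⟨κ, β₀, S₀, hκ, hS₀, hI⟩ := h G hG hsc r a ha ha0 hlb
  exact ⟨κ, 1, β₀, S₀, hκ, one_pos, hS₀, fun β hβ L hL hS z n hzn _ => hI β hβ L hL hS z n hzn⟩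

/-- v2's purity-guarded I_spec (✓p819112 `SpectralFluxInterlacingEv`, floor-free, unit-free) ALSO implies the guarded-and-floored form
(`S₀ := 1`, floor ignored): a prover of v2's stub closes v3's composition unchanged. -/
theorem physPure_of_spectralFluxInterlacingEv (h : SpectralFluxInterlacingEv) : SpectralFluxInterlacingPhysPure := by
  intro G _ _ _ _ hG hsc
  letI : MeasurableSpace G := borel G
  haveI : BorelSpace G := ⟨rfl⟩
  intro r a _ _ _
  obtain ⟨κ, ε₀, β₀, hκ, hε₀, hI⟩ := h G hG hsc r
  exact ⟨κ, ε₀, β₀, 1, hκ, hε₀, one_pos, fun β hβ L hL _ z n hzn hdef => hI β hβ L hL z n hzn hdef⟩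

/-- ★ **I⁺_spec ⇒ I⁺** (`β₀ ↦ max β₀ 0`; ✓p819112 `interlacedAt_of_spectral` at the adapted eigenbasis with neutral vacuum of ✓p819031). -/
theorem fluxInterlacingPhys_of_spectral (h : SpectralFluxInterlacingPhys) : FluxInterlacingPhys := by
  intro G _ _ _ _ hG hsc
  letI : MeasurableSpace G := borel G
  haveI : BorelSpace G := ⟨rfl⟩
  intro r a ha ha0 hlb
  haveI : SecondCountableTopology G :=
    (r.continuous.isClosedEmbedding r.injective).isEmbedding.secondCountableTopology
  obtain ⟨κ, β₀, S₀, hκ, hS₀, hI⟩ := h G hG hsc r a ha ha0 hlb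
  refine ⟨κ, max β₀ 0, S₀, hκ, hS₀, fun β hβ L hL hS z n hzn => ?_⟩
  have hβ0 : 0 ≤ β := le_trans (le_max_right _ _) hβ
  have hβ₀ : β₀ ≤ β := le_trans (le_max_left _ _) hβ
  exact interlacedAt_of_spectral r.continuous r.mem_unitary hβ0 hzn.1 hzn.2.1 hzn.2.2 hL hκ (hI β hβ₀ L hL hS z n hzn)

/-! ## §3 Real-number core and trace inequalities (byte-identical mathematics to `flux_interlacing_v2.lean` §2–§3) -/

/-- **Real-number core.** -/
theorem defect_le_of_proj_interlaced {Z₁ Z₂ A₁ A₂ κ ε : ℝ} (hA₁ : 0 < A₁) (hZ₁ : 0 < Z₁) (hκ : 0 ≤ κ)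
    (hε0 : 0 ≤ ε) (hε1 : ε ≤ 1) (hdom : A₂ ≤ Z₂) (hV : 1 - A₂ / A₁ ^ 2 ≤ ε)
    (hI : Z₁ ≤ A₁ + κ * (A₁ - Real.sqrt A₂)) :
    1 - Z₂ / Z₁ ^ 2 ≤ (1 + 2 * κ) * ε := by
  have hA₁sq : 0 < A₁ ^ 2 := by positivity
  have hA₂ : (1 - ε) * A₁ ^ 2 ≤ A₂ := by
    have h1 : 1 - ε ≤ A₂ / A₁ ^ 2 := by linarith
    exact (le_div_iff₀ hA₁sq).1 h1
  have hA₂nn : 0 ≤ A₂ := le_trans (by nlinarith) hA₂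
  have hsq : (1 - ε) * A₁ ≤ Real.sqrt A₂ := by
    have hx : 0 ≤ (1 - ε) * A₁ := mul_nonneg (by linarith) hA₁.le
    have hx2 : ((1 - ε) * A₁) ^ 2 ≤ A₂ := by
      have heq : ((1 - ε) * A₁) ^ 2 = (1 - ε) * ((1 - ε) * A₁ ^ 2) := by ring
      rw [heq]
      calc (1 - ε) * ((1 - ε) * A₁ ^ 2) ≤ 1 * ((1 - ε) * A₁ ^ 2) :=
             mul_le_mul_of_nonneg_right (by linarith) (by nlinarith)
        _ = (1 - ε) * A₁ ^ 2 := one_mul _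
        _ ≤ A₂ := hA₂
    calc (1 - ε) * A₁ = Real.sqrt (((1 - ε) * A₁) ^ 2) := (Real.sqrt_sq hx).symm
      _ ≤ Real.sqrt A₂ := Real.sqrt_le_sqrt hx2
  have hZ₁le : Z₁ ≤ (1 + κ * ε) * A₁ := by
    have h1 : A₁ - Real.sqrt A₂ ≤ ε * A₁ := by linarith
    have h2 : κ * (A₁ - Real.sqrt A₂) ≤ κ * (ε * A₁) := mul_le_mul_of_nonneg_left h1 hκ
    nlinarith
  have hZ₁sq : Z₁ ^ 2 ≤ (1 + κ * ε) ^ 2 * A₁ ^ 2 := by rw [← mul_pow]; exact pow_le_pow_left₀ hZ₁.le hZ₁le 2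
  have hu : 0 ≤ κ * ε := mul_nonneg hκ hε0
  have key : (1 - (1 + 2 * κ) * ε) * (1 + κ * ε) ^ 2 ≤ 1 - ε := by
    nlinarith [mul_nonneg hu hε0, mul_nonneg (mul_nonneg hu hu) hε0, mul_nonneg hu hu, mul_nonneg (mul_nonneg hu hu) hu]
  have hZ₂ : (1 - (1 + 2 * κ) * ε) * Z₁ ^ 2 ≤ Z₂ := by
    by_cases hs : 0 ≤ 1 - (1 + 2 * κ) * ε
    · calc (1 - (1 + 2 * κ) * ε) * Z₁ ^ 2 ≤ (1 - (1 + 2 * κ) * ε) * ((1 + κ * ε) ^ 2 * A₁ ^ 2) :=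
             mul_le_mul_of_nonneg_left hZ₁sq hs
        _ = ((1 - (1 + 2 * κ) * ε) * (1 + κ * ε) ^ 2) * A₁ ^ 2 := by ring
        _ ≤ (1 - ε) * A₁ ^ 2 := mul_le_mul_of_nonneg_right key hA₁sq.le
        _ ≤ Z₂ := hA₂.trans hdom
    · have h1 : (1 - (1 + 2 * κ) * ε) * Z₁ ^ 2 ≤ 0 := mul_nonpos_of_nonpos_of_nonneg (le_of_lt (not_le.1 hs)) (sq_nonneg _)
      linarith [hA₂nn.trans hdom]
  have hZ₁sq0 : 0 < Z₁ ^ 2 := by positivity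
  have h3 : 1 - (1 + 2 * κ) * ε ≤ Z₂ / Z₁ ^ 2 := (le_div_iff₀ hZ₁sq0).2 hZ₂
  linarith

section Composition

variable {G : Type} [Group G] [TopologicalSpace G] [IsTopologicalGroup G] [CompactSpace G]
  [MeasurableSpace G] [BorelSpace G] [SecondCountableTopology G] {N : ℕ} {ρ : G →* Matrix (Fin N) (Fin N) ℂ}

theorem projZ_pos (hρ : Continuous ρ) (β : ℝ) (z : G) {n : ℕ} (hn : 0 < n) (L t : ℕ) : 0 < projZ ρ β z n L t := by
  unfold projZ; haveI : NeZero n := ⟨Nat.pos_iff_ne_zero.1 hn⟩; haveI : Nonempty (Fin 3 → Fin n) := ⟨fun _ => 0⟩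
  refine mul_pos (inv_pos.2 ?_) (Finset.sum_pos (fun k _ => wilsonFinTorusTensorTwistedPartition_pos ρ hρ β _ _ _ _ _) Finset.univ_nonempty)
  exact_mod_cast Fintype.card_pos

theorem projZ_le_partition (hρ : Continuous ρ) (hρu : ∀ g, ρ g ∈ Matrix.unitaryGroup (Fin N) ℂ) {β : ℝ} (hβ : 0 ≤ β)
    {z : G} (hz : z ∈ Subgroup.center G) {n : ℕ} (hn : 0 < n) {L t : ℕ} (hL : 2 ≤ L) (ht : 2 ≤ t) :
    projZ ρ β z n L t ≤ wilsonFinTorusPartition ρ β L L L t := by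
  unfold projZ; haveI : NeZero n := ⟨Nat.pos_iff_ne_zero.1 hn⟩
  have hcard : (0 : ℝ) < ((Fintype.card (Fin 3 → Fin n) : ℕ) : ℝ) := by haveI : Nonempty (Fin 3 → Fin n) := ⟨fun _ => 0⟩; exact_mod_cast Fintype.card_pos
  have hle : ∑ k : Fin 3 → Fin n, wilsonFinTorusTensorTwistedPartition ρ β (eTwist z k) L L L t ≤
      ∑ _k : Fin 3 → Fin n, wilsonFinTorusPartition ρ β L L L t :=
    Finset.sum_le_sum fun k _ => wilsonFinTorusTensorTwistedPartition_le_partition ρ hρ hρu hβ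
      (fun μ ν _ => eTwist_center hz k μ ν) hL hL ht
  rw [Finset.sum_const, Finset.card_univ, nsmul_eq_mul] at hle
  calc ((Fintype.card (Fin 3 → Fin n) : ℕ) : ℝ)⁻¹ * ∑ k : Fin 3 → Fin n,
          wilsonFinTorusTensorTwistedPartition ρ β (eTwist z k) L L L t
        ≤ ((Fintype.card (Fin 3 → Fin n) : ℕ) : ℝ)⁻¹ * (((Fintype.card (Fin 3 → Fin n) : ℕ) : ℝ) * wilsonFinTorusPartition ρ β L L L t) :=
        mul_le_mul_of_nonneg_left hle (inv_nonneg.2 hcard.le)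
    _ = wilsonFinTorusPartition ρ β L L L t := by rw [← mul_assoc, inv_mul_cancel₀ hcard.ne', one_mul]

theorem coldDefect_le_of_projPure_interlaced (hρ : Continuous ρ) (hρu : ∀ g, ρ g ∈ Matrix.unitaryGroup (Fin N) ℂ)
    {β : ℝ} (hβ : 0 ≤ β) {L : ℕ} (hL : 8 ≤ L) {z : G} {n : ℕ} (hzn : IsProjDatum z n)
    {κ ε : ℝ} (hκ : 0 ≤ κ) (hε0 : 0 ≤ ε) (hε1 : ε ≤ 1)
    (hV : projDefect ρ β z n L (L / 4) ≤ ε) (hI : InterlacedAt ρ β z n κ L) :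
    coldDefect ρ β L ≤ (1 + 2 * κ) * ε := by
  have hL2 : 2 ≤ L := by omega
  have ht2 : 2 ≤ 2 * (L / 4) := by omega
  unfold coldDefect; unfold projDefect at hV; unfold InterlacedAt at hI
  exact defect_le_of_proj_interlaced (projZ_pos hρ β z hzn.2.1 L (L / 4)) (wilsonFinTorusPartition_pos hρ β L L L (L / 4))
    hκ hε0 hε1 (projZ_le_partition hρ hρu hβ hzn.1 hzn.2.1 hL2 ht2) hV hI

end Composition

/-! ## §4 Composition: V⁺ ∧ I⁺_pure ⇒ PXcof(1∕24) ⇒ IRcof BY NAME -/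

/-- ★★ **V⁺ ∧ I⁺_pure ⇒ PXcof(1∕24)** (`RunningLandmark.PinnedExitsCofinalAt (1/24)`, the Theorems copy of the slot's first token):
take `(κ, ε₀, β₀, S₀)` from I⁺_pure at `(r, a)`, ask V⁺ for purity `ε := min ε₀ (1/(24(1+2κ)))` in the window `[S₀, T]`, pick `β`
above `β₁, β₀, 0`; the box V⁺ returns satisfies I⁺_pure's floor AND guard, so it is interlaced (spectral ⇒ trace by ✓p819112), and the
real-number core turns `ε`-purity + `κ`-interlacing into `coldDefect ≤ (1+2κ)ε ≤ 1/24`. -/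
theorem pinnedExitsCofinal_of_window_interlacing (hV : NeutralPurityWindowCof) (hI : SpectralFluxInterlacingPhysPure) :
    PinnedExitsCofinalAt (1 / 24) := by
  intro G _ _ _ _ hG hsc; letI : MeasurableSpace G := borel G; haveI : BorelSpace G := ⟨rfl⟩
  intro r a ha ha0 hlb
  haveI : SecondCountableTopology G := (r.continuous.isClosedEmbedding r.injective).isEmbedding.secondCountableTopology
  obtain ⟨κ, ε₀, β₀, S₀, hκ, hε₀, _hS₀, hIr⟩ := hI G hG hsc r a ha ha0 hlb
  have h24 : (0 : ℝ) < 24 * (1 + 2 * κ) := by positivity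
  set ε : ℝ := min ε₀ (1 / (24 * (1 + 2 * κ))) with hεdef
  have hεpos : 0 < ε := lt_min hε₀ (by positivity)
  have hεle₀ : ε ≤ ε₀ := min_le_left _ _
  have hεle : ε ≤ 1 / (24 * (1 + 2 * κ)) := min_le_right _ _
  have hε1 : ε ≤ 1 := by refine hεle.trans ?_; rw [div_le_iff₀ h24]; nlinarith
  obtain ⟨T, hT⟩ := hV G hG hsc r a ha ha0 hlb ε hεpos S₀
  refine ⟨T, fun β₁ => ?_⟩
  obtain ⟨β, hβ, L, hL, hSL, haL, z, n, hzn, hproj⟩ := hT (max β₁ (max β₀ 0))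
  have hβ₁ : β₁ ≤ β := le_trans (le_max_left _ _) hβ
  have hβ₀ : β₀ ≤ β := le_trans ((le_max_left _ _).trans (le_max_right _ _)) hβ
  have hβ0 : 0 ≤ β := le_trans ((le_max_right _ _).trans (le_max_right _ _)) hβ
  have hspec : SpectralInterlacedAt r.ρ β z n κ L := hIr β hβ₀ L hL hSL z n hzn (hproj.trans hεle₀)
  have hint : InterlacedAt r.ρ β z n κ L :=
    interlacedAt_of_spectral r.continuous r.mem_unitary hβ0 hzn.1 hzn.2.1 hzn.2.2 hL hκ hspec
  have hcd := coldDefect_le_of_projPure_interlaced r.continuous r.mem_unitary hβ0 hL hzn hκ hεpos.le hε1 hproj hint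
  refine ⟨β, hβ₁, L, hL, haL, ?_⟩; show coldDefect r.ρ β L ≤ 1 / 24
  refine hcd.trans ?_
  calc (1 + 2 * κ) * ε ≤ (1 + 2 * κ) * (1 / (24 * (1 + 2 * κ))) := mul_le_mul_of_nonneg_left hεle (by positivity)
    _ = 1 / 24 := by
      have h12 : (1 + 2 * κ) ≠ 0 := by positivity
      have h24' : (24 : ℝ) ≠ 0 := by norm_num
      field_simp [h12, h24']

/-- **V⁺ ∧ I⁺_spec ⇒ PXcof(1∕24)** — the supplier arrow in terms of the v3 stub types. -/
theorem pinnedExitsCofinal_of_window_phys (hV : NeutralPurityWindowCof) (hI : SpectralFluxInterlacingPhys) :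
    PinnedExitsCofinalAt (1 / 24) :=
  pinnedExitsCofinal_of_window_interlacing hV (physPure_of_phys hI)

/-- **V⁺ ∧ (v2's I_spec) ⇒ PXcof(1∕24)** — the v2 stub still closes the v3 composition. -/
theorem pinnedExitsCofinal_of_window_v2spec (hV : NeutralPurityWindowCof) (hI : SpectralFluxInterlacingEv) :
    PinnedExitsCofinalAt (1 / 24) :=
  pinnedExitsCofinal_of_window_interlacing hV (physPure_of_spectralFluxInterlacingEv hI)

/-- **PXcof(1∕24) from the stubs** — SUPPLIER ARROW #2 (v3): any proof of V⁺ and I⁺_spec closes the slot's `stub_pinnedExitsCofinal`. -/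
theorem pinnedExitsCofinal_of_stubs : PinnedExitsCofinalAt (1 / 24) :=
  pinnedExitsCofinal_of_window_phys stub_neutralPurityWindowCof stub_spectralFluxInterlacingPhys

/-- **IRcof from the three stubs** — concluding theorem V⁺ ∧ I⁺_spec ∧ N ⇒ `Summit.QuantumFields.YangMills.Theses.BalabanLadder.IRcof`
BY NAME (landed kernel `LevelwiseDomination.IRcof_of_pinnedExitsCofinalAt`). -/
theorem IRcof_of : Summit.QuantumFields.YangMills.Theses.BalabanLadder.IRcof :=
  Summit.QuantumFields.YangMills.Cruxes.IR.LevelwiseDomination.IRcof_of_pinnedExitsCofinalAt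
    (pinnedExitsCofinal_of_window_phys stub_neutralPurityWindowCof stub_spectralFluxInterlacingPhys) stub_irnscCof

/-! ## §5 Toys (rule (N) non-vacuity per hypothesis shape; ‼T; decided negative) -/

/-- **(N) for I⁺'s hypothesis shape**: for every positive unit map, every `β₀`, `S₀` there is a box `β ≥ β₀`, `L ≥ 8`, `S₀ ≤ a(β)·L`
(Archimedes) — the floor never empties the claim. -/
theorem floor_inhabited (a : ℝ → ℝ) (ha : ∀ β, 0 < a β) (β₀ S₀ : ℝ) :
    ∃ (β : ℝ) (L : ℕ), β₀ ≤ β ∧ 8 ≤ L ∧ S₀ ≤ a β * (L : ℝ) := by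
  obtain ⟨N, hN⟩ := exists_nat_ge (S₀ / a β₀)
  refine ⟨β₀, max 8 N, le_rfl, le_max_left _ _, ?_⟩
  have h1 : S₀ / a β₀ ≤ ((max 8 N : ℕ) : ℝ) := hN.trans (by exact_mod_cast le_max_right 8 N)
  have h2 := (div_le_iff₀ (ha β₀)).1 h1
  linarith [mul_comm (a β₀) ((max 8 N : ℕ) : ℝ)]

/-- **(N) for V⁺'s window shape**: for every positive unit map `a → 0` and every floor `S₀` there is a cap `T` such that for every `β₁`
some `β ≥ β₁` and `L ≥ 8` have `S₀ ≤ a(β)·L ≤ T` — the window `[S₀, T]` is servable cofinally (take `a(β) ≤ 1/8`, `L = ⌈S₀⁺/a(β)⌉₊ ∨ 8`,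
`T = S₀⁺ + 2`). -/
theorem window_inhabited (a : ℝ → ℝ) (ha : ∀ β, 0 < a β) (ha0 : Tendsto a atTop (𝓝 0)) (S₀ : ℝ) :
    ∃ T : ℝ, ∀ β₁ : ℝ, ∃ β : ℝ, β₁ ≤ β ∧ ∃ L : ℕ, 8 ≤ L ∧ S₀ ≤ a β * (L : ℝ) ∧ a β * (L : ℝ) ≤ T := by
  set x : ℝ := max S₀ 0 with hx
  have hx0 : 0 ≤ x := le_max_right _ _
  refine ⟨x + 2, fun β₁ => ?_⟩
  have hev : ∀ᶠ β in atTop, a β < 1 / 8 := (tendsto_order.1 ha0).2 _ (by norm_num)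
  obtain ⟨β, hβ₁, hβa⟩ := ((eventually_ge_atTop β₁).and hev).exists
  have haβ := ha β
  refine ⟨β, hβ₁, max 8 ⌈x / a β⌉₊, le_max_left _ _, ?_, ?_⟩
  · have h1 : x / a β ≤ ((max 8 ⌈x / a β⌉₊ : ℕ) : ℝ) :=
      (Nat.le_ceil _).trans (by exact_mod_cast le_max_right 8 ⌈x / a β⌉₊)
    have h2 := (div_le_iff₀ haβ).1 h1
    calc S₀ ≤ x := le_max_left _ _
      _ ≤ ((max 8 ⌈x / a β⌉₊ : ℕ) : ℝ) * a β := h2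
      _ = a β * ((max 8 ⌈x / a β⌉₊ : ℕ) : ℝ) := mul_comm _ _
  · have hc : (⌈x / a β⌉₊ : ℝ) < x / a β + 1 := Nat.ceil_lt_add_one (div_nonneg hx0 haβ.le)
    have hmax : ((max 8 ⌈x / a β⌉₊ : ℕ) : ℝ) ≤ 8 + (⌈x / a β⌉₊ : ℝ) := by
      have : (max 8 ⌈x / a β⌉₊ : ℕ) ≤ 8 + ⌈x / a β⌉₊ := max_le (Nat.le_add_right _ _) (Nat.le_add_left _ _)
      exact_mod_cast this
    have h3 : a β * ((max 8 ⌈x / a β⌉₊ : ℕ) : ℝ) ≤ a β * (8 + (x / a β + 1)) :=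
      mul_le_mul_of_nonneg_left (hmax.trans (by linarith)) haβ.le
    have h4 : a β * (8 + (x / a β + 1)) = 9 * a β + x := by field_simp; ring
    rw [h4] at h3
    linarith

section Toys

variable {G : Type} [Group G] [TopologicalSpace G] [IsTopologicalGroup G] [CompactSpace G]
  [MeasurableSpace G] [BorelSpace G] {N : ℕ} (ρ : G →* Matrix (Fin N) (Fin N) ℂ)

/-- **In-model inhabitation at the Haar point**: at `β = 0` every projected trace is `1`. -/
theorem projZ_beta_zero (z : G) {n : ℕ} (hn : 0 < n) (L t : ℕ) : projZ ρ 0 z n L t = 1 := by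
  unfold projZ
  haveI : NeZero n := ⟨Nat.pos_iff_ne_zero.1 hn⟩
  have hcard : ((Fintype.card (Fin 3 → Fin n) : ℕ) : ℝ) ≠ 0 := by
    haveI : Nonempty (Fin 3 → Fin n) := ⟨fun _ => 0⟩
    exact_mod_cast Fintype.card_pos.ne'
  have h1 : ∀ k : Fin 3 → Fin n, wilsonFinTorusTensorTwistedPartition ρ 0 (eTwist z k) L L L t = 1 := fun k => by
    simp [wilsonFinTorusTensorTwistedPartition, wilsonFinTorusPlaqTwistedPartition]
  simp only [h1, Finset.sum_const, Finset.card_univ, nsmul_eq_mul, mul_one]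
  exact inv_mul_cancel₀ hcard

/-- … hence the projected defect vanishes at `β = 0`. -/
theorem projDefect_beta_zero (z : G) {n : ℕ} (hn : 0 < n) (L : ℕ) : projDefect ρ 0 z n L (L / 4) = 0 := by
  unfold projDefect
  rw [projZ_beta_zero ρ z hn, projZ_beta_zero ρ z hn]
  norm_num

/-- … and the `β = 0` box is `κ`-interlaced for every `κ` (conclusion shape of I⁺ inhabited in-model: the extreme confined corner). -/
theorem interlacedAt_beta_zero (z : G) {n : ℕ} (hn : 0 < n) (κ : ℝ) (L : ℕ) : InterlacedAt ρ 0 z n κ L := by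
  unfold InterlacedAt
  rw [projZ_beta_zero ρ z hn, projZ_beta_zero ρ z hn]
  simp [wilsonFinTorusPartition]

/-- … and SPECTRALLY `κ`-interlaced for every `κ ≥ 0` and `L ≥ 8` (conclusion shape of I⁺_spec inhabited in-model): at `β = 0` the
moments force every charged eigenvalue to vanish (`Σ λᵢ^{m+2}(1 − wᵢ) = 0`, nonnegative terms), so the electric-flux weight is `0`
while the excited-glue weight `Σ λᵢ^t wᵢ − λ₀^t = 1 − λ₀^t ≥ 0`. -/
theorem spectralInterlacedAt_beta_zero (z : G) {n : ℕ} (hn : 0 < n) {κ : ℝ} (hκ : 0 ≤ κ) {L : ℕ} (hL : 8 ≤ L) :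
    SpectralInterlacedAt ρ 0 z n κ L := by
  intro ι lam w i₀ hlam _hL0 hw0 hw hZ hP
  obtain ⟨m, hm⟩ : ∃ m, L / 4 = m + 2 := ⟨L / 4 - 2, by omega⟩
  have hw1 : ∀ i, 0 ≤ 1 - w i := fun i => by rcases hw i with h | h <;> simp [h]
  have hwn : ∀ i, 0 ≤ w i := fun i => by rcases hw i with h | h <;> simp [h]
  have hZ1 : HasSum (fun i => lam i ^ (m + 2)) 1 := by simpa [wilsonFinTorusPartition] using hZ m
  have hP1 : HasSum (fun i => lam i ^ (m + 2) * w i) 1 := by simpa [projZ_beta_zero ρ z hn] using hP m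
  have hD : HasSum (fun i => lam i ^ (m + 2) * (1 - w i)) 0 := by
    have h := hZ1.sub hP1
    have hfun : (fun i => lam i ^ (m + 2) - lam i ^ (m + 2) * w i) = fun i => lam i ^ (m + 2) * (1 - w i) := by
      funext i; ring
    rw [sub_self, hfun] at h
    exact h
  have hnn : ∀ i, 0 ≤ lam i ^ (m + 2) * (1 - w i) := fun i => mul_nonneg (pow_nonneg (hlam i).1 _) (hw1 i)
  have hzero : ∀ i, lam i ^ (m + 2) * (1 - w i) = 0 := fun i => congr_fun ((hasSum_zero_iff_of_nonneg hnn).1 hD) i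
  have hlhs : ∑' i, lam i ^ (m + 2) * (1 - w i) = 0 := by simp only [hzero, tsum_zero]
  have htop : lam i₀ ^ (m + 2) ≤ 1 := by
    have h := le_hasSum hP1 i₀ (fun j _ => mul_nonneg (pow_nonneg (hlam j).1 _) (hwn j))
    simpa [hw0] using h
  rw [hm, hlhs, hP1.tsum_eq]
  exact mul_nonneg (by positivity) (by linarith)

end Toys

/-- **DECIDED NEGATIVE toy (dictionary: sub-floor ∕ deconfined `4:1` box, or finite `G`: light flux violates interlacing).** If the neutral
sector is exactly pure (`A₂ = A₁²`) and the full trace carries `m ≥ 2` degenerate flux copies of it (`Z₁ = m · A₁`), the box is NOT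
`κ`-interlaced for ANY `κ` — the pattern R665 measured in its nine HOT boxes (`C/Z = 7/8`), which is why `S₀ ≳ 4/T_c` is NECESSARY. -/
theorem not_interlaced_of_light_flux {A₁ m κ : ℝ} (hA : 0 < A₁) (hm : 2 ≤ m) :
    ¬ (m * A₁ ≤ A₁ + κ * (A₁ - Real.sqrt (A₁ ^ 2))) := by
  rw [Real.sqrt_sq hA.le, sub_self, mul_zero, add_zero]
  intro h
  nlinarith

end Summit.QuantumFields.YangMills.Cruxes.IRcof.Lines.FluxInterlacingV3

end
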